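import Mathlib
import Summits.KontsevichZagierPeriods.KontsevichZagierPeriods.Theorems.SoloInformedKZPWeightFour
import Summits.KontsevichZagierPeriods.KontsevichZagierPeriods.Theorems.SoloInformedZetaTwo
import Literature.NumberTheory.Transcendental.KZProduct
import Literature.NumberTheory.Transcendental.KZProductIdeal
import Literature.NumberTheory.Transcendental.KZRulesAssociator
import HarnessLib
import HarnessLib.Audit

/-!
# SoloInformed — Euler's `ζ(4) = π⁴/90` is a Kontsevich–Zagier relation (KERNEL)

Solo programme `solo-KontsevichZagierPeriods-informed`, session s45 (PART XVI, THEOREM XXXVII).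

Kontsevich–Zagier [2001, §1.2] call `ζ(2) = π²/6` an "accessible identity": provable by the three
rules. THEOREM VIII of this programme (`SoloInformedZetaTwo`) made that a kernel statement,
`6·[(0,1)², 1/(1−xy)] − [D̄]·[D̄] ∈ KZ.relations`. This file does the same for weight 4:

* the STUFFLE `ζ(2)² = 2ζ(2,2) + ζ(4)` as a move chain (§2): the cubical product
  `Π = [(0,1)⁴, 1/((1−x₀x₁)(1−x₂x₃))]` (`= [Z₂]·[Z₂]` by Fubini, §1) satisfies
  `soloInformed_pi22_sub : [Π] − (2·[Z(2,2)] + [Z(4)]) ∈ relations` — one integrand-additivity move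
  for the partial-fraction identity `1/((1−u)(1−v)) + 1/(1−uv) = 1/((1−u)(1−uv)) + 1/((1−v)(1−uv))`
  (`u = x₀x₁`, `v = x₂x₃`), one coordinate permutation, and the star-side chains
  `[(0,1)⁴, 1/((1−u)(1−uv))] ≡ [Z(2,2)] + [Z(4)]`, `[(0,1)⁴, 1/(1−uv)] ≡ [Z(4)]` of
  `SoloInformedZetaTwoTwoSum` / `SoloInformedZetaFourSum`; with the cyclicity of the weight-4 sector
  (`SoloInformedKZPWeightFour`): `soloInformed_pi22_sub_ten_Z31 : [Π] − 10·[Z(3,1)] ∈ relations`;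
* **THEOREM XXXVII** `soloInformed_pi_pow_four_sub_ninety_Z4 : [D̄]⁴ − 90·[Z(4)] ∈ KZ.relations` (`[D̄]⁴ = soloInformedPi4 := [D̄]²·[D̄]²`)
  (and `… − 360·[Z(3,1)]`): Euler's evaluation `ζ(4) = π⁴/90` is an abstract period identity, by
  THEOREM VIII twice, the two-sided ideal property of `relations` (Literature:
  `mul_mem_relations_left/right_holds`) and the stuffle chain; in the formal period ring:
  `soloInformed_piClass_pow_four : ⟦[D̄]⟧⁴ = 90 • mzvClass [4]`;
* `soloInformed_kzp_weight4_span6` — `ker eval = relations` on the `ℤ`-span of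
  `[D̄]⁴, [Π], [Z(4)], [Z(3,1)], [Z(2,2)], [Z(2,1,1)]` (THEOREM XXXVI extended by the two product
  representations of `π⁴` and `ζ(2)²`).
-/

namespace Summit.KontsevichZagierPeriods.KontsevichZagierPeriods.Theorems

open MeasureTheory Set MvPolynomial Literature.NumberTheory.Transcendental
open Literature.NumberTheory.Transcendental.KZ Literature.ModelTheory.ExponentialFields

noncomputable section

/-! ## 1. The cubical product representation `Π` of `ζ(2)²` -/

/-- `Π(x) = 1/((1 − x₁x₀)(1 − x₂x₃))`. -/
def soloInformedPi22f (x : Fin 4 → ℝ) : ℝ := 1 / ((1 - x 1 * x 0) * (1 - x 2 * x 3))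

/-- Integrability of `Π` on `(0,1)⁴` (domination by `∏ (1−x_j)^{−1/2}`). -/
theorem soloInformed_integrableOn_pi22f : IntegrableOn soloInformedPi22f (soloInformedOpenCube 4) := by
  have h : soloInformedPi22f = soloInformedStepF1 0 soloInformedT22Q soloInformedT22Ω 1 := by
    funext x; rw [soloInformed_T22F1_eq]; rfl
  rw [h]
  refine soloInformed_integrableOn_of_le_W (soloInformed_measurableSet_openCube 4) subset_rfl
    (soloInformed_continuousOn_stepF1 0 _ _ _ fun x hx => ?_) soloInformedZ4E2
    soloInformedZ4E2_lt_one 1 fun x hx => ?_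
  · simpa using (mul_pos (soloInformed_T22_pos1 hx) (soloInformed_T22_pos2 hx)).ne'
  · rw [soloInformed_T22F1_eq, one_mul, abs_of_pos (one_div_pos.2 (mul_pos
      (soloInformed_T22_pos1 hx) (soloInformed_T22_pos2 hx)))]
    exact soloInformed_T22F1_le_W hx

/-- **`Π = [(0,1)⁴, 1/((1−x₀x₁)(1−x₂x₃))]`**, the cubical representation of `ζ(2)²`. -/
def soloInformedPi22 : IntegralRep 4 where
  domain := soloInformedOpenCube 4
  integrand := soloInformedPi22f
  isSemialgebraic_domain := isSemialgebraic_soloInformedOpenCube 4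
  isSemialgebraicFunOn_integrand :=
    soloInformed_isSemialgebraicFunOn_quot (isSemialgebraic_soloInformedOpenCube 4) 1
      ((1 - X 1 * X 0) * (1 - X 2 * X 3)) _
      (fun x hx => by
        simpa using (mul_pos (soloInformed_T22_pos1 hx) (soloInformed_T22_pos2 hx)).ne')
      fun x _ => by simp [soloInformedPi22f]
  integrableOn := soloInformed_integrableOn_pi22f

/-- Domain of `Π`. -/
@[simp] theorem soloInformedPi22_domain : soloInformedPi22.domain = soloInformedOpenCube 4 := rfl
/-- Integrand of `Π`. -/
@[simp] theorem soloInformedPi22_integrand : soloInformedPi22.integrand = soloInformedPi22f := rfl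

/-- The product domain `(0,1)² × (0,1)²` is the open cube `(0,1)⁴`. -/
theorem soloInformed_prodDomain_sq_sq :
    IntegralRep.prodDomain soloInformedZetaTwoRep soloInformedZetaTwoRep = soloInformedOpenCube 4 := by
  ext z
  have hA : (fun i : Fin 2 => z (Fin.castAdd 2 i)) = ![z 0, z 1] := by funext i; fin_cases i <;> rfl
  have hB : (fun j : Fin 2 => z (Fin.natAdd 2 j)) = ![z 2, z 3] := by funext j; fin_cases j <;> rfl
  rw [IntegralRep.mem_prodDomain, soloInformedZetaTwoRep_domain, hA, hB, soloInformed_mem_openSq,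
    soloInformed_mem_openSq, soloInformed_mem_openCube_iff]
  simp only [Matrix.cons_val_zero, Matrix.cons_val_one]
  constructor
  · rintro ⟨⟨h0, h1⟩, h2, h3⟩ j
    fin_cases j
    · exact h0
    · exact h1
    · exact h2
    · exact h3
  · intro h; exact ⟨⟨h 0, h 1⟩, h 2, h 3⟩

/-- **Fubini (§1):** `[Z₂]·[Z₂] − [Π] ∈ relations` — the product representation `Z₂ × Z₂` has the
same domain and the same integrand as `Π`. -/
theorem soloInformed_zetaTwo_sq_sub_pi22 :
    of soloInformedZetaTwoRep * of soloInformedZetaTwoRep - of soloInformedPi22 ∈ relations := by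
  rw [of_mul_of]
  refine of_sub_of_mem_relations_of_eqOn
    (by rw [soloInformedPi22_domain, IntegralRep.prod_domain, soloInformed_prodDomain_sq_sq]) ?_
  intro z _
  have hA : (fun i : Fin 2 => z (Fin.castAdd 2 i)) = ![z 0, z 1] := by funext i; fin_cases i <;> rfl
  have hB : (fun j : Fin 2 => z (Fin.natAdd 2 j)) = ![z 2, z 3] := by funext j; fin_cases j <;> rfl
  rw [IntegralRep.prod_integrand_eq, IntegralRep.prodFun_apply, hA, hB, soloInformedZetaTwoRep_integrand,
    soloInformedPi22_integrand]
  simp only [Matrix.cons_val_zero, Matrix.cons_val_one, soloInformedPi22f]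
  rw [mul_comm (z 0) (z 1), one_div_mul_one_div]

/-! ## 2. The stuffle `ζ(2)² = 2ζ(2,2) + ζ(4)` as a move chain -/

/-- The block swap `(0,1,2,3) ↦ (2,3,0,1)`. -/
def soloInformedSwap22 : Fin 4 ≃ Fin 4 := ⟨![2, 3, 0, 1], ![2, 3, 0, 1], by decide, by decide⟩

/-- Values of the block swap. -/
@[simp] theorem soloInformedSwap22_zero : soloInformedSwap22 0 = 2 := rfl
/-- Auxiliary. -/
@[simp] theorem soloInformedSwap22_one : soloInformedSwap22 1 = 3 := rfl
/-- Auxiliary. -/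
@[simp] theorem soloInformedSwap22_two : soloInformedSwap22 2 = 0 := rfl
/-- Auxiliary. -/
@[simp] theorem soloInformedSwap22_three : soloInformedSwap22 3 = 1 := rfl

/-- The star representation `R₂ = [(0,1)⁴, 1/((1−u)(1−uv))]` with the blocks swapped. -/
def soloInformedR2sw : IntegralRep 4 := soloInformedT22Datum.R2.reindex soloInformedSwap22

/-- Domain of the swapped star representation: the cube. -/
theorem soloInformedR2sw_domain : soloInformedR2sw.domain = soloInformedOpenCube 4 := by
  rw [soloInformedR2sw, IntegralRep.reindex_domain, soloInformedT22_R2_domain]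
  ext w
  simp only [mem_setOf_eq, soloInformed_mem_openCube_iff]
  constructor
  · intro h j
    simpa using h (soloInformedSwap22.symm j)
  · intro h i; exact h _

/-- Integrand of the swapped star representation. -/
theorem soloInformedR2sw_integrand (w : Fin 4 → ℝ) :
    soloInformedR2sw.integrand w = 1 / ((1 - w 3 * w 2) * (1 - w 3 * w 2 * (w 0 * w 1))) := by
  rw [soloInformedR2sw, IntegralRep.reindex_integrand]
  simp only [soloInformedT22_R2_integrand, soloInformedSwap22_zero, soloInformedSwap22_one,
    soloInformedSwap22_two, soloInformedSwap22_three]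

/-- `1 − x₃x₂ > 0` on the cube. -/
theorem soloInformed_pi22_pos4 {x : Fin 4 → ℝ} (hx : x ∈ soloInformedOpenCube 4) : 0 < 1 - x 3 * x 2 := by
  have h2 := hx 2; have h3 := hx 3
  nlinarith [mul_pos h3.1 h2.1]

/-- `1 − x₃x₂(x₀x₁) > 0` on the cube. -/
theorem soloInformed_pi22_pos5 {x : Fin 4 → ℝ} (hx : x ∈ soloInformedOpenCube 4) :
    0 < 1 - x 3 * x 2 * (x 0 * x 1) := by
  have h := soloInformed_T22_pos3 hx
  nlinarith [h]

/-- The sum integrand `1/((1−u)(1−uv)) + 1/((1−v)(1−vu))`. -/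
def soloInformedPi22Sf (x : Fin 4 → ℝ) : ℝ :=
  1 / ((1 - x 1 * x 0) * (1 - x 1 * x 0 * (x 2 * x 3))) + 1 / ((1 - x 3 * x 2) * (1 - x 3 * x 2 * (x 0 * x 1)))

/-- **`Σ = [(0,1)⁴, 1/((1−u)(1−uv)) + 1/((1−v)(1−uv))]`.** -/
def soloInformedPi22S : IntegralRep 4 where
  domain := soloInformedOpenCube 4
  integrand := soloInformedPi22Sf
  isSemialgebraic_domain := isSemialgebraic_soloInformedOpenCube 4
  isSemialgebraicFunOn_integrand :=
    soloInformed_isSemialgebraicFunOn_quot (isSemialgebraic_soloInformedOpenCube 4)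
      ((1 - X 3 * X 2) + (1 - X 1 * X 0))
      ((1 - X 1 * X 0) * (1 - X 3 * X 2) * (1 - X 1 * X 0 * (X 2 * X 3))) _
      (fun x hx => by
        simpa using (mul_pos (mul_pos (soloInformed_T22_pos1 hx) (soloInformed_pi22_pos4 hx))
          (soloInformed_T22_pos3 hx)).ne')
      fun x hx => by
        have h1 := (soloInformed_T22_pos1 hx).ne'
        have h3 := (soloInformed_T22_pos3 hx).ne'
        have h4 := (soloInformed_pi22_pos4 hx).ne'
        have h5 := (soloInformed_pi22_pos5 hx).ne'
        simp only [map_add, map_sub, map_mul, map_one, aeval_X, soloInformedPi22Sf]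
        rw [one_div_add_one_div (mul_ne_zero h1 h3) (mul_ne_zero h4 h5),
          div_eq_div_iff (mul_ne_zero (mul_ne_zero h1 h4) h3)
            (mul_ne_zero (mul_ne_zero h1 h3) (mul_ne_zero h4 h5))]
        ring
  integrableOn := by
    have hA : IntegrableOn (fun x : Fin 4 → ℝ => 1 / ((1 - x 1 * x 0) * (1 - x 1 * x 0 * (x 2 * x 3))))
        (soloInformedOpenCube 4) := by
      have h := soloInformedT22Datum.R2.integrableOn
      rw [soloInformedT22_R2_domain] at h
      exact h.congr_fun (fun x _ => soloInformedT22_R2_integrand x)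
        (soloInformed_measurableSet_openCube 4)
    have hB : IntegrableOn (fun w : Fin 4 → ℝ => 1 / ((1 - w 3 * w 2) * (1 - w 3 * w 2 * (w 0 * w 1))))
        (soloInformedOpenCube 4) := by
      have h := soloInformedR2sw.integrableOn
      rw [soloInformedR2sw_domain] at h
      exact h.congr_fun (fun w _ => soloInformedR2sw_integrand w)
        (soloInformed_measurableSet_openCube 4)
    exact hA.add hB

/-- Move (1b): `[Σ] − [R₂] − [R₂^{sw}] ∈ relations`. -/
theorem soloInformed_pi22S_sub_R2_sub_R2sw :
    of soloInformedPi22S - of soloInformedT22Datum.R2 - of soloInformedR2sw ∈ relations :=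
  integrandAddRel_subset_relations ⟨4, soloInformedPi22S, soloInformedT22Datum.R2, soloInformedR2sw,
    soloInformedT22_R2_domain, soloInformedR2sw_domain, fun x _ => by
      simp only [Pi.add_apply, soloInformedT22_R2_integrand, soloInformedR2sw_integrand]; rfl, rfl⟩

/-- Move (1b), the partial-fraction identity
`1/((1−u)(1−uv)) + 1/((1−v)(1−uv)) = 1/((1−u)(1−v)) + 1/(1−uv)`: `[Σ] − [Π] − [P₂] ∈ relations`. -/
theorem soloInformed_pi22S_sub_pi22_sub_P2 :
    of soloInformedPi22S - of soloInformedPi22 - of soloInformedZ4P2 ∈ relations := by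
  refine integrandAddRel_subset_relations ⟨4, soloInformedPi22S, soloInformedPi22, soloInformedZ4P2,
    rfl, rfl, fun x hx => ?_, rfl⟩
  have h1 := (soloInformed_T22_pos1 hx).ne'
  have h2 := (soloInformed_T22_pos2 hx).ne'
  have h3 := (soloInformed_T22_pos3 hx).ne'
  have h4 := (soloInformed_pi22_pos4 hx).ne'
  have h5 := (soloInformed_pi22_pos5 hx).ne'
  have h6 := (soloInformed_Z4_one_sub_pos' hx).ne'
  show soloInformedPi22Sf x = soloInformedPi22f x + soloInformedZ4p2 x
  simp only [soloInformedPi22Sf, soloInformedPi22f, soloInformedZ4p2]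
  rw [one_div_add_one_div (mul_ne_zero h1 h3) (mul_ne_zero h4 h5),
    one_div_add_one_div (mul_ne_zero h1 h2) h6,
    div_eq_div_iff (mul_ne_zero (mul_ne_zero h1 h3) (mul_ne_zero h4 h5))
      (mul_ne_zero (mul_ne_zero h1 h2) h6)]
  ring

/-- **THE STUFFLE AT WEIGHT 4 AS A MOVE CHAIN:** `[Π] − (2·[Z(2,2)] + [Z(4)]) ∈ KZ.relations`
(`ζ(2)² = 2ζ(2,2) + ζ(4)`). -/
theorem soloInformed_pi22_sub :
    of soloInformedPi22 - (2 • of soloInformedZ22 + of soloInformedZ4) ∈ relations := by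
  have hS1 := soloInformed_pi22S_sub_R2_sub_R2sw
  have hS2 := soloInformed_pi22S_sub_pi22_sub_P2
  have hre : of soloInformedT22Datum.R2 - of soloInformedR2sw ∈ relations :=
    of_sub_of_reindex_mem_relations _ _
  have hR2 := soloInformed_t22_R2_sub
  have hP2 := soloInformed_s_move3
  have e : of soloInformedPi22 - (2 • of soloInformedZ22 + of soloInformedZ4)
      = -(of soloInformedPi22S - of soloInformedPi22 - of soloInformedZ4P2)
        + (of soloInformedPi22S - of soloInformedT22Datum.R2 - of soloInformedR2sw)
        - (of soloInformedT22Datum.R2 - of soloInformedR2sw)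
        + 2 • (of soloInformedT22Datum.R2 - (of soloInformedZ22 + of soloInformedZ4))
        - (of soloInformedZ4P2 - of soloInformedZ4) := by
    abel
  rw [e]
  exact relations.sub_mem (relations.add_mem (relations.sub_mem (relations.add_mem
    (relations.neg_mem hS2) hS1) hre) (relations.nsmul_mem hR2 2)) hP2

/-- `[Π] − 10·[Z(3,1)] ∈ relations` (`ζ(2)² = 10 ζ(3,1)`). -/
theorem soloInformed_pi22_sub_ten_Z31 : of soloInformedPi22 - 10 • of soloInformedZ31 ∈ relations := by
  have e : of soloInformedPi22 - 10 • of soloInformedZ31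
      = (of soloInformedPi22 - (2 • of soloInformedZ22 + of soloInformedZ4))
        + 2 • (of soloInformedZ22 - 3 • of soloInformedZ31)
        + (of soloInformedZ4 - 4 • of soloInformedZ31) := by
    abel
  rw [e]
  exact relations.add_mem (relations.add_mem soloInformed_pi22_sub
    (relations.nsmul_mem soloInformed_Z22_sub_three_Z31 2)) soloInformed_Z4_sub_four_Z31

/-! ## 3. THEOREM XXXVII: `[π]⁴ ≡ 90·[Z(4)]` -/

/-- `36·[Π] − [D̄]²·[D̄]² ∈ relations` (THEOREM VIII squared, by the two-sided ideal property). -/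
theorem soloInformed_thirtysix_pi22_sub_pi4 :
    36 • of soloInformedPi22 - of piRep * of piRep * (of piRep * of piRep) ∈ relations := by
  have h8 := soloInformed_six_zetaTwo_sub_pi_mul_pi_mem_relations
  have hsq := sub_mul_sub_mem_relations mul_mem_relations_left_holds mul_mem_relations_right_holds h8 h8
  have e1 : (6 • of soloInformedZetaTwoRep) * (6 • of soloInformedZetaTwoRep)
      = 36 • (of soloInformedZetaTwoRep * of soloInformedZetaTwoRep) := by
    rw [smul_mul_assoc, mul_smul_comm, smul_smul]; norm_num
  rw [e1] at hsq
  have hpr := soloInformed_zetaTwo_sq_sub_pi22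
  have e : 36 • of soloInformedPi22 - of piRep * of piRep * (of piRep * of piRep)
      = (36 • (of soloInformedZetaTwoRep * of soloInformedZetaTwoRep)
          - of piRep * of piRep * (of piRep * of piRep))
        - 36 • (of soloInformedZetaTwoRep * of soloInformedZetaTwoRep - of soloInformedPi22) := by
    rw [smul_sub]; abel
  rw [e]
  exact relations.sub_mem hsq (relations.nsmul_mem hpr 36)

/-- `[D̄]⁴ := [D̄]²·[D̄]² = [D̄ × D̄ × (D̄ × D̄), 1] ∈ FormalRep` (the formal combination ring is
non-unital and non-associative, so the fourth power is written as this product). -/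
def soloInformedPi4 : FormalRep := of piRep * of piRep * (of piRep * of piRep)

/-- Unfolding `[D̄]⁴`. -/
theorem soloInformedPi4_eq : soloInformedPi4 = of piRep * of piRep * (of piRep * of piRep) := rfl

/-- **THEOREM XXXVII′.** `[D̄]⁴ − 360·[Z(3,1)] ∈ KZ.relations`. -/
theorem soloInformed_pi_pow_four_sub_Z31 : soloInformedPi4 - 360 • of soloInformedZ31 ∈ relations := by
  rw [soloInformedPi4_eq]
  have e : of piRep * of piRep * (of piRep * of piRep) - 360 • of soloInformedZ31
      = 36 • (of soloInformedPi22 - 10 • of soloInformedZ31)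
        - (36 • of soloInformedPi22 - of piRep * of piRep * (of piRep * of piRep)) := by
    module
  rw [e]
  exact relations.sub_mem (relations.nsmul_mem soloInformed_pi22_sub_ten_Z31 36)
    soloInformed_thirtysix_pi22_sub_pi4

/-- **THEOREM XXXVII (Euler's `ζ(4) = π⁴/90` is a Kontsevich–Zagier relation).**
`[D̄]⁴ − 90·[Z(4)] ∈ KZ.relations`, where `D̄` is the closed unit disc (`KZ.piRep`, value `π`) and
`Z(4) = KZ.mzvRep [4]` is Kontsevich's simplex representation of `ζ(4)`. -/
theorem soloInformed_pi_pow_four_sub_ninety_Z4 : soloInformedPi4 - 90 • of soloInformedZ4 ∈ relations := by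
  have e : soloInformedPi4 - 90 • of soloInformedZ4
      = (soloInformedPi4 - 360 • of soloInformedZ31) - 90 • (of soloInformedZ4 - 4 • of soloInformedZ31) := by
    module
  rw [e]
  exact relations.sub_mem soloInformed_pi_pow_four_sub_Z31
    (relations.nsmul_mem soloInformed_Z4_sub_four_Z31 90)

/-- The same in the formal period ring `𝒫`: `⟦[D̄]⟧⁴ = 90 • mzvClass [4]`. -/
theorem soloInformed_piClass_pow_four :
    toFormalPeriod (of piRep) ^ 4 = 90 • mzvClass [4] := by
  have hp : toFormalPeriod (of piRep) ^ 4 = toFormalPeriod soloInformedPi4 := by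
    rw [soloInformedPi4_eq, map_mul, map_mul]; ring
  rw [hp, mzvClass_of_isAdmissible (by decide : MZV.IsAdmissible [4]), ← map_nsmul]
  exact toFormalPeriod_eq_iff.2 soloInformed_pi_pow_four_sub_ninety_Z4

/-! ## 4. The period conjecture on the span of the six weight-4 representations -/

/-- `eval [D̄]⁴ = π⁴`. -/
theorem soloInformed_eval_piRep_pow_four : eval soloInformedPi4 = Real.pi ^ 4 := by
  rw [soloInformedPi4_eq, eval_mul prodFunSemialgebraic_holds, eval_mul prodFunSemialgebraic_holds,
    eval_of_piRep]
  ring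

/-- `Π.value = π⁴/36` — read off the relation `[Π] ≡ 10·[Z(3,1)]` by soundness (no integral is
computed). -/
theorem soloInformedPi22_value : soloInformedPi22.value = Real.pi ^ 4 / 36 := by
  have h := (AddMonoidHom.mem_ker).1 (relations_le_ker_eval_holds soloInformed_pi22_sub_ten_Z31)
  rw [map_sub, map_nsmul, eval_of, eval_of, soloInformedZ31_value, sub_eq_zero] at h
  rw [h]; simp only [nsmul_eq_mul]; push_cast; ring

/-- **THEOREM XXXVII″ (kernel form on the six-generator span).** For all `a b c d e f : ℤ`,
`eval (a·[D̄]⁴ + b·[Π] + c·[Z(4)] + d·[Z(3,1)] + e·[Z(2,2)] + f·[Z(2,1,1)]) = 0` iff that element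
lies in `KZ.relations`: the kernel form of the period conjecture on this rank-6 subgroup. -/
theorem soloInformed_kzp_weight4_span6 (a b c d e f : ℤ) :
    eval (a • soloInformedPi4 + b • of soloInformedPi22 + c • of soloInformedZ4 + d • of soloInformedZ31
        + e • of soloInformedZ22 + f • of soloInformedZ211) = 0 ↔
    a • soloInformedPi4 + b • of soloInformedPi22 + c • of soloInformedZ4 + d • of soloInformedZ31
        + e • of soloInformedZ22 + f • of soloInformedZ211 ∈ relations := by
  constructor
  · intro h
    simp only [map_add, map_zsmul, eval_of, soloInformed_eval_piRep_pow_four, soloInformedPi22_value,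
      soloInformedZ4_value, soloInformedZ31_value, soloInformedZ22_value, soloInformedZ211_value,
      zsmul_eq_mul] at h
    have hpi : (0 : ℝ) < Real.pi ^ 4 := by positivity
    have hmul : ((360 * a + 10 * b + 4 * c + d + 3 * e + 4 * f : ℤ) : ℝ) * Real.pi ^ 4 = 0 := by
      push_cast; linear_combination 360 * h
    have hz : 360 * a + 10 * b + 4 * c + d + 3 * e + 4 * f = 0 := by
      exact_mod_cast (mul_eq_zero.1 hmul).resolve_right hpi.ne'
    have e' : a • soloInformedPi4 + b • of soloInformedPi22 + c • of soloInformedZ4 + d • of soloInformedZ31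
          + e • of soloInformedZ22 + f • of soloInformedZ211
        = a • (soloInformedPi4 - 360 • of soloInformedZ31) + b • (of soloInformedPi22 - 10 • of soloInformedZ31)
          + c • (of soloInformedZ4 - 4 • of soloInformedZ31) + e • (of soloInformedZ22 - 3 • of soloInformedZ31)
          + f • (of soloInformedZ211 - 4 • of soloInformedZ31)
          + (360 * a + 10 * b + 4 * c + d + 3 * e + 4 * f) • of soloInformedZ31 := by
      module
    rw [e', hz, zero_smul, add_zero]
    exact relations.add_mem (relations.add_mem (relations.add_mem (relations.add_mem
      (relations.zsmul_mem soloInformed_pi_pow_four_sub_Z31 a)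
      (relations.zsmul_mem soloInformed_pi22_sub_ten_Z31 b))
      (relations.zsmul_mem soloInformed_Z4_sub_four_Z31 c))
      (relations.zsmul_mem soloInformed_Z22_sub_three_Z31 e))
      (relations.zsmul_mem soloInformed_Z211_sub_four_Z31 f)
  · intro h
    exact (AddMonoidHom.mem_ker).1 (relations_le_ker_eval_holds h)

end

end Summit.KontsevichZagierPeriods.KontsevichZagierPeriods.Theorems
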